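import Mathlib
import HarnessLib

/-!
# ValiantsHypothesis / LacunarySymmetroid — crux `MatrixDescartes` (stmt-ValiantsHypothesis-18050, V1),
# line `Cruxes/MatrixDescartes/Lines/osculation_law.lean` («osculation-law»): the RANK-ONE CURVE `f + b·a = 0`

The line inserts ONE semidefinite letter `c·t^N·P` (`P = I_r ⊕ 0`) into a symmetric block pencil `G(t)` and
studies the real spectral curve `Φ(t,b) = det(G(t) + b·P) = 0`; its invariant `ι(G,P)` counts the OSCULATION
points of that curve in the open quadrant `t > 0, b > 0` — the zeros on the curve of the bordered log-Hessian
`H(Φ) = θ₀θ₀Φ·(θ₁Φ)² − 2·θ₀θ₁Φ·θ₀Φ·θ₁Φ + θ₁θ₁Φ·(θ₀Φ)²` (`θ_i = X_i ∂/∂X_i`).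

At rank `r = 1` the insertion polynomial is AFFINE in `b`: `Φ = ι f + X₁·ι a` (`ι : ℝ[X] → ℝ[X₀,X₁]`,
`X ↦ X₀`; `f = det G`, `a = det G₂₂` — that bridge is `…OsculationLawStubRankOne`).  This file is the analysis of
such a curve, for ARBITRARY `f a : ℝ[X]`:

* `eval_logHessian_Phi` (θ-calculus; `pderiv` is a derivation, `Derivation.map_aeval`):
  `H(Φ)(t,b) = b·a·[ b·a·θ²f + b²·W(a) + (θf)² ](t)`, `W(h) = h·θ²h − (θh)²`;
* `hess_identity`: ON the curve `f(t) + b·a(t) = 0`, `a(t)²·H(Φ)(t,b) = f(t)·R(t)` with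
  `R = W(f)·a² − W(a)·f²` (a `ring` identity);
* `osc_ncard_le` (**main lemma**): if the osculation set `{t > 0, b > 0, Φ = 0, H(Φ) = 0}` is finite, then
  `#osc ≤ Z₊mult(R)`.  Finiteness forbids vertical rays, so `a(t) ≠ 0` (hence `f(t) ≠ 0`) at every osculation
  point; therefore every osculation point projects, injectively (`b = −f(t)/a(t)`), to a positive root of `R`;
  if `R ≡ 0`, a nonempty osculation set would contain the open arc `{(t, −f/a) : f·a < 0}` near any of its
  points (continuity), so it is empty.  Distinct roots are at most roots with multiplicity.

The statements spell the line's `euler`/`logHessian`/`osculationSet`/`posRootsMult`/`eulerX`/`logWronskian` OUT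
(the line file lives under `Cruxes/` with `sorry`s and cannot be imported); `…OsculationLawStubRankOne` closes
the line's `stub_rankOne` from `osc_ncard_le` by `exact`.

Honest framing: bookkeeping for an UNREGISTERED alternative line of the V1 crux (critic-gated PASS-WITH-PRICE,
«stub_rankOne landable first»); the line's theorem `stub_peel`, its LAW `stub_osculationLaw` (Conjecture-B
strength), `stub_recursion`, the crux `MatrixDescartes`, Conjecture B and `VP ≠ VNP` are all OPEN / NOT proved,
and nothing here is progress on them.  No definitions, no named facts; Mathlib only.
-/

-- `Summit.ValiantsHypothesis.ValiantsHypothesis.…` is the tree's mandated single-conjunct layout (Sub = Summit).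
set_option linter.dupNamespace false

noncomputable section

namespace Summit.ValiantsHypothesis.ValiantsHypothesis.Theorems.LacunarySymmetroidMatrixDescartes

open Polynomial Matrix Finset
open scoped BigOperators

namespace OsculationRankOne
/-! ### The embedding `ℝ[X] → ℝ[X₀, X₁]`, `X ↦ X₀` (`Polynomial.aeval (MvPolynomial.X 0)`) -/

/-- Evaluation through the embedding `ι : X ↦ X₀`: `(ι f)(p) = f(p 0)`. [folklore] -/
theorem eval_aevalX0 (p : Fin 2 → ℝ) (f : ℝ[X]) :
    MvPolynomial.eval p (Polynomial.aeval (MvPolynomial.X 0 : MvPolynomial (Fin 2) ℝ) f) = f.eval (p 0) := by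
  have h1 : MvPolynomial.eval p (Polynomial.aeval (MvPolynomial.X 0 : MvPolynomial (Fin 2) ℝ) f) =
      MvPolynomial.aeval p (Polynomial.aeval (MvPolynomial.X 0 : MvPolynomial (Fin 2) ℝ) f) := rfl
  rw [h1, ← Polynomial.aeval_algHom_apply, MvPolynomial.aeval_X, Polynomial.coe_aeval_eq_eval]

/-- `∂₀ (ι f) = ι (f')` (`pderiv` is a derivation; `Derivation.map_aeval`). [folklore] -/
theorem pderiv_zero_aevalX0 (f : ℝ[X]) :
    MvPolynomial.pderiv 0 (Polynomial.aeval (MvPolynomial.X 0 : MvPolynomial (Fin 2) ℝ) f) =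
      Polynomial.aeval (MvPolynomial.X 0 : MvPolynomial (Fin 2) ℝ) (derivative f) := by
  rw [(MvPolynomial.pderiv 0 : Derivation ℝ (MvPolynomial (Fin 2) ℝ) (MvPolynomial (Fin 2) ℝ)).map_aeval
    f (MvPolynomial.X 0), MvPolynomial.pderiv_X_self, smul_eq_mul, mul_one]

/-- `∂₁ (ι f) = 0`. [folklore] -/
theorem pderiv_one_aevalX0 (f : ℝ[X]) :
    MvPolynomial.pderiv 1 (Polynomial.aeval (MvPolynomial.X 0 : MvPolynomial (Fin 2) ℝ) f) = 0 := by
  rw [(MvPolynomial.pderiv 1 : Derivation ℝ (MvPolynomial (Fin 2) ℝ) (MvPolynomial (Fin 2) ℝ)).map_aeval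
    f (MvPolynomial.X 0), MvPolynomial.pderiv_X_of_ne (by decide), smul_zero]

/-! ### Evaluation of `Φ = ι f + X₁ ι a` and of its bordered log-Hessian -/

/-- `Φ(t,b) = f(t) + b·a(t)` for `Φ = ι f + X₁·ι a`. [folklore] -/
theorem eval_Phi (f a : ℝ[X]) (p : Fin 2 → ℝ) :
    MvPolynomial.eval p (Polynomial.aeval (MvPolynomial.X 0 : MvPolynomial (Fin 2) ℝ) f
        + MvPolynomial.X 1 * Polynomial.aeval (MvPolynomial.X 0 : MvPolynomial (Fin 2) ℝ) a) =
      f.eval (p 0) + p 1 * a.eval (p 0) := by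
  simp [eval_aevalX0]

/-- The bordered log-Hessian of `Φ = ι f + X₁·ι a`, evaluated at `p = (t,b)` (θ-calculus). [folklore] -/
theorem eval_logHessian_Phi (f a : ℝ[X]) (Φ : MvPolynomial (Fin 2) ℝ)
    (hΦ : Φ = Polynomial.aeval (MvPolynomial.X 0 : MvPolynomial (Fin 2) ℝ) f
        + MvPolynomial.X 1 * Polynomial.aeval (MvPolynomial.X 0 : MvPolynomial (Fin 2) ℝ) a)
    (p : Fin 2 → ℝ) :
    MvPolynomial.eval p
        (MvPolynomial.X 0 * MvPolynomial.pderiv 0 (MvPolynomial.X 0 * MvPolynomial.pderiv 0 Φ)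
            * (MvPolynomial.X 1 * MvPolynomial.pderiv 1 Φ) ^ 2
          - 2 * (MvPolynomial.X 0 * MvPolynomial.pderiv 0 (MvPolynomial.X 1 * MvPolynomial.pderiv 1 Φ))
            * (MvPolynomial.X 0 * MvPolynomial.pderiv 0 Φ) * (MvPolynomial.X 1 * MvPolynomial.pderiv 1 Φ)
          + MvPolynomial.X 1 * MvPolynomial.pderiv 1 (MvPolynomial.X 1 * MvPolynomial.pderiv 1 Φ)
            * (MvPolynomial.X 0 * MvPolynomial.pderiv 0 Φ) ^ 2) =
      p 0 * ((derivative f).eval (p 0) + p 1 * (derivative a).eval (p 0)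
              + p 0 * ((derivative (derivative f)).eval (p 0)
                  + p 1 * (derivative (derivative a)).eval (p 0)))
          * (p 1 * a.eval (p 0)) ^ 2
        - 2 * (p 0 * (p 1 * (derivative a).eval (p 0)))
          * (p 0 * ((derivative f).eval (p 0) + p 1 * (derivative a).eval (p 0))) * (p 1 * a.eval (p 0))
        + p 1 * a.eval (p 0) * (p 0 * ((derivative f).eval (p 0) + p 1 * (derivative a).eval (p 0))) ^ 2 := by
  subst hΦ
  simp only [map_add, map_mul, map_sub, map_pow, MvPolynomial.pderiv_mul,
    MvPolynomial.pderiv_X_self, MvPolynomial.pderiv_X_of_ne (show (1 : Fin 2) ≠ 0 by decide),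
    pderiv_zero_aevalX0, pderiv_one_aevalX0,
    MvPolynomial.eval_X, eval_aevalX0, map_ofNat, mul_zero, zero_mul, add_zero, zero_add, one_mul]

/-- The key identity ON the curve `f + b·a = 0`: `a² · H(t,b) = f · R(t)`, `R = W(f)a² − W(a)f²`,
`W(h) = h·θ²h − (θh)²`, `θ = X d/dX`. -/
theorem hess_identity (f a : ℝ[X]) (t b : ℝ) (h : f.eval t + b * a.eval t = 0) :
    (a.eval t) ^ 2 *
        (t * ((derivative f).eval t + b * (derivative a).eval t
              + t * ((derivative (derivative f)).eval t + b * (derivative (derivative a)).eval t))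
            * (b * a.eval t) ^ 2
          - 2 * (t * (b * (derivative a).eval t))
            * (t * ((derivative f).eval t + b * (derivative a).eval t)) * (b * a.eval t)
          + b * a.eval t * (t * ((derivative f).eval t + b * (derivative a).eval t)) ^ 2) =
      f.eval t *
        ((f * (X * derivative (X * derivative f)) - (X * derivative f) ^ 2) * a ^ 2
          - (a * (X * derivative (X * derivative a)) - (X * derivative a) ^ 2) * f ^ 2).eval t := by
  have hf : f.eval t = -(b * a.eval t) := by linarith
  simp only [eval_mul, eval_sub, eval_pow, eval_X, derivative_mul, derivative_X, one_mul, eval_add]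
  rw [hf]
  ring

/-- **Main lemma (rank one).**  For `Φ = f + X₁·a`, the osculation set of `{Φ = 0}` in the open quadrant,
if finite, has at most `Z₊mult(W(f)a² − W(a)f²)` points. -/
theorem osc_ncard_le (f a : ℝ[X]) (Φ : MvPolynomial (Fin 2) ℝ)
    (hΦ : Φ = Polynomial.aeval (MvPolynomial.X 0 : MvPolynomial (Fin 2) ℝ) f
        + MvPolynomial.X 1 * Polynomial.aeval (MvPolynomial.X 0 : MvPolynomial (Fin 2) ℝ) a)
    (hfin : {p : Fin 2 → ℝ | 0 < p 0 ∧ 0 < p 1 ∧ MvPolynomial.eval p Φ = 0 ∧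
      MvPolynomial.eval p
        (MvPolynomial.X 0 * MvPolynomial.pderiv 0 (MvPolynomial.X 0 * MvPolynomial.pderiv 0 Φ)
            * (MvPolynomial.X 1 * MvPolynomial.pderiv 1 Φ) ^ 2
          - 2 * (MvPolynomial.X 0 * MvPolynomial.pderiv 0 (MvPolynomial.X 1 * MvPolynomial.pderiv 1 Φ))
            * (MvPolynomial.X 0 * MvPolynomial.pderiv 0 Φ) * (MvPolynomial.X 1 * MvPolynomial.pderiv 1 Φ)
          + MvPolynomial.X 1 * MvPolynomial.pderiv 1 (MvPolynomial.X 1 * MvPolynomial.pderiv 1 Φ)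
            * (MvPolynomial.X 0 * MvPolynomial.pderiv 0 Φ) ^ 2) = 0}.Finite) :
    {p : Fin 2 → ℝ | 0 < p 0 ∧ 0 < p 1 ∧ MvPolynomial.eval p Φ = 0 ∧
      MvPolynomial.eval p
        (MvPolynomial.X 0 * MvPolynomial.pderiv 0 (MvPolynomial.X 0 * MvPolynomial.pderiv 0 Φ)
            * (MvPolynomial.X 1 * MvPolynomial.pderiv 1 Φ) ^ 2
          - 2 * (MvPolynomial.X 0 * MvPolynomial.pderiv 0 (MvPolynomial.X 1 * MvPolynomial.pderiv 1 Φ))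
            * (MvPolynomial.X 0 * MvPolynomial.pderiv 0 Φ) * (MvPolynomial.X 1 * MvPolynomial.pderiv 1 Φ)
          + MvPolynomial.X 1 * MvPolynomial.pderiv 1 (MvPolynomial.X 1 * MvPolynomial.pderiv 1 Φ)
            * (MvPolynomial.X 0 * MvPolynomial.pderiv 0 Φ) ^ 2) = 0}.ncard ≤
      Multiset.card (((f * (X * derivative (X * derivative f)) - (X * derivative f) ^ 2) * a ^ 2
          - (a * (X * derivative (X * derivative a)) - (X * derivative a) ^ 2) * f ^ 2).roots.filter
        (fun t => 0 < t)) := by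
  classical
  -- abbreviations
  set R : ℝ[X] := (f * (X * derivative (X * derivative f)) - (X * derivative f) ^ 2) * a ^ 2
      - (a * (X * derivative (X * derivative a)) - (X * derivative a) ^ 2) * f ^ 2 with hR
  set osc := {p : Fin 2 → ℝ | 0 < p 0 ∧ 0 < p 1 ∧ MvPolynomial.eval p Φ = 0 ∧
      MvPolynomial.eval p
        (MvPolynomial.X 0 * MvPolynomial.pderiv 0 (MvPolynomial.X 0 * MvPolynomial.pderiv 0 Φ)
            * (MvPolynomial.X 1 * MvPolynomial.pderiv 1 Φ) ^ 2
          - 2 * (MvPolynomial.X 0 * MvPolynomial.pderiv 0 (MvPolynomial.X 1 * MvPolynomial.pderiv 1 Φ))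
            * (MvPolynomial.X 0 * MvPolynomial.pderiv 0 Φ) * (MvPolynomial.X 1 * MvPolynomial.pderiv 1 Φ)
          + MvPolynomial.X 1 * MvPolynomial.pderiv 1 (MvPolynomial.X 1 * MvPolynomial.pderiv 1 Φ)
            * (MvPolynomial.X 0 * MvPolynomial.pderiv 0 Φ) ^ 2) = 0} with hosc
  -- membership, unfolded to real numbers
  have mem_osc : ∀ p : Fin 2 → ℝ, p ∈ osc ↔ 0 < p 0 ∧ 0 < p 1 ∧ f.eval (p 0) + p 1 * a.eval (p 0) = 0 ∧
      p 0 * ((derivative f).eval (p 0) + p 1 * (derivative a).eval (p 0)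
              + p 0 * ((derivative (derivative f)).eval (p 0)
                  + p 1 * (derivative (derivative a)).eval (p 0)))
          * (p 1 * a.eval (p 0)) ^ 2
        - 2 * (p 0 * (p 1 * (derivative a).eval (p 0)))
          * (p 0 * ((derivative f).eval (p 0) + p 1 * (derivative a).eval (p 0))) * (p 1 * a.eval (p 0))
        + p 1 * a.eval (p 0) * (p 0 * ((derivative f).eval (p 0) + p 1 * (derivative a).eval (p 0))) ^ 2
          = 0 := by
    intro p
    rw [hosc, Set.mem_setOf_eq, eval_logHessian_Phi f a Φ hΦ p, hΦ, eval_Phi]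
  -- (A) no vertical rays: `a(t) ≠ 0` at every osculation point
  have hA : ∀ p ∈ osc, a.eval (p 0) ≠ 0 := by
    intro p hp ha0
    obtain ⟨ht, hb, hcurve, -⟩ := (mem_osc p).1 hp
    have hf0 : f.eval (p 0) = 0 := by rw [ha0, mul_zero, add_zero] at hcurve; exact hcurve
    apply hfin.not_infinite
    refine Set.infinite_of_injOn_mapsTo (f := fun b : ℝ => (![p 0, b] : Fin 2 → ℝ)) ?_ ?_ (Set.Ioi_infinite 0)
    · intro b _ b' _ hbb'
      have := congr_fun hbb' 1
      simpa [Matrix.cons_val_one] using this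
    · intro b hb'
      rw [Set.mem_Ioi] at hb'
      refine (mem_osc _).2 ⟨?_, ?_, ?_, ?_⟩
      · simpa [Matrix.cons_val_zero] using ht
      · simpa [Matrix.cons_val_one] using hb'
      · simp only [Matrix.cons_val_zero, Matrix.cons_val_one, ha0, hf0, mul_zero, add_zero]
      · simp only [Matrix.cons_val_zero, Matrix.cons_val_one, ha0, mul_zero, zero_mul, add_zero, zero_pow two_ne_zero, sub_zero]
  -- (B) the projection `p ↦ p 0` is injective on the osculation set
  have hinj : Set.InjOn (fun p : Fin 2 → ℝ => p 0) osc := by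
    intro p hp q hq hpq
    simp only at hpq
    obtain ⟨-, -, hcp, -⟩ := (mem_osc p).1 hp
    obtain ⟨-, -, hcq, -⟩ := (mem_osc q).1 hq
    have ha := hA p hp
    rw [← hpq] at hcq
    have h1 : p 1 = q 1 := by
      have : (p 1 - q 1) * a.eval (p 0) = 0 := by linarith
      rcases mul_eq_zero.1 this with h | h
      · linarith
      · exact absurd h ha
    funext i
    fin_cases i
    · exact hpq
    · exact h1
  -- (C) every osculation point projects to a root of `R`
  have hroot : ∀ p ∈ osc, R.eval (p 0) = 0 := by
    intro p hp
    obtain ⟨ht, hb, hcurve, hH⟩ := (mem_osc p).1 hp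
    have ha := hA p hp
    have key := hess_identity f a (p 0) (p 1) hcurve
    rw [hH, mul_zero] at key
    have hf : f.eval (p 0) ≠ 0 := by
      intro hf0
      rw [hf0, zero_add] at hcurve
      rcases mul_eq_zero.1 hcurve with h | h
      · exact absurd h hb.ne'
      · exact ha h
    rcases mul_eq_zero.1 key.symm with h | h
    · exact absurd h hf
    · exact h
  -- (D) the count
  by_cases hR0 : R = 0
  · -- `R ≡ 0`: a nonempty osculation set would contain an open arc
    have hempty : osc = ∅ := by
      rcases Set.eq_empty_or_nonempty osc with h | ⟨p, hp⟩
      · exact h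
      exfalso
      obtain ⟨ht, hb, hcurve, -⟩ := (mem_osc p).1 hp
      have ha := hA p hp
      set U : Set ℝ := {t | 0 < t ∧ f.eval t * a.eval t < 0} with hU
      have hUopen : IsOpen U := by
        have hc : Continuous fun t : ℝ => f.eval t * a.eval t :=
          (Polynomial.continuous f).mul (Polynomial.continuous a)
        exact (isOpen_lt continuous_const continuous_id).inter (isOpen_lt hc continuous_const)
      have ht0U : p 0 ∈ U := by
        refine ⟨ht, ?_⟩
        have hf : f.eval (p 0) = -(p 1 * a.eval (p 0)) := by linarith
        rw [hf]
        have : 0 < a.eval (p 0) ^ 2 := by positivity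
        nlinarith
      obtain ⟨ε, hε, hball⟩ := Metric.isOpen_iff.1 hUopen (p 0) ht0U
      have hUinf : U.Infinite := by
        refine Set.Infinite.mono ?_ (Set.Ioo_infinite (show p 0 - ε < p 0 + ε by linarith))
        intro t ht'
        apply hball
        rw [Real.ball_eq_Ioo]
        exact ht'
      apply hfin.not_infinite
      refine Set.infinite_of_injOn_mapsTo
        (f := fun t : ℝ => (![t, -(f.eval t) / a.eval t] : Fin 2 → ℝ)) ?_ ?_ hUinf
      · intro t _ t' _ htt'
        have := congr_fun htt' 0
        simpa [Matrix.cons_val_zero] using this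
      · intro t htU
        obtain ⟨htpos, hprod⟩ := htU
        have hat : a.eval t ≠ 0 := by
          intro h0; rw [h0, mul_zero] at hprod; exact lt_irrefl _ hprod
        have hcurve' : f.eval t + -(f.eval t) / a.eval t * a.eval t = 0 := by
          field_simp
          ring
        refine (mem_osc _).2 ⟨?_, ?_, ?_, ?_⟩
        · simpa [Matrix.cons_val_zero] using htpos
        · simp only [Matrix.cons_val_one, Matrix.cons_val_zero]
          have h1 : -(f.eval t) / a.eval t = (-(f.eval t * a.eval t)) / (a.eval t * a.eval t) := by
            field_simp
          rw [h1]
          apply div_pos (by linarith)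
          exact mul_self_pos.2 hat
        · simp only [Matrix.cons_val_zero, Matrix.cons_val_one]
          exact hcurve'
        · simp only [Matrix.cons_val_zero, Matrix.cons_val_one]
          have key := hess_identity f a t (-(f.eval t) / a.eval t) hcurve'
          rw [← hR, hR0, eval_zero, mul_zero] at key
          rcases mul_eq_zero.1 key with h | h
          · exact absurd (pow_eq_zero_iff two_ne_zero |>.1 h) hat
          · exact h
    rw [hempty, Set.ncard_empty]
    exact Nat.zero_le _
  · -- `R ≢ 0`: inject into the positive roots of `R`
    have hmaps : ∀ p ∈ osc, (fun p : Fin 2 → ℝ => p 0) p ∈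
        ((R.roots.toFinset.filter (fun t => 0 < t) : Finset ℝ) : Set ℝ) := by
      intro p hp
      obtain ⟨ht, -, -, -⟩ := (mem_osc p).1 hp
      simp only [Finset.coe_filter, Set.mem_setOf_eq, Multiset.mem_toFinset]
      exact ⟨(Polynomial.mem_roots hR0).2 (hroot p hp), ht⟩
    calc osc.ncard ≤ ((R.roots.toFinset.filter (fun t => 0 < t) : Finset ℝ) : Set ℝ).ncard :=
          Set.ncard_le_ncard_of_injOn (fun p : Fin 2 → ℝ => p 0) hmaps hinj (Finset.finite_toSet _)
      _ = (R.roots.toFinset.filter (fun t => 0 < t)).card := Set.ncard_coe_finset _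
      _ = ((R.roots.filter (fun t => 0 < t)).toFinset).card := by rw [Multiset.toFinset_filter]
      _ ≤ Multiset.card (R.roots.filter (fun t => 0 < t)) := Multiset.toFinset_card_le _

end OsculationRankOne

end Summit.ValiantsHypothesis.ValiantsHypothesis.Theorems.LacunarySymmetroidMatrixDescartes
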